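/-
Origin: expansion seat `prover-pub-hodgecm-mc-carch-1-0`, handover #CA10 2026-08-20T00:32Z md5 2fc1b891d793 (122 l.; NEW additive leaf; imports Model.ArchKTypeOfFrameMatch (#CA8), Model.ThetaHolAssembly (RUN 36); RUN 38; INSTALL after #CA8; cert certs/ax-ArchKTypeOfTwist-2fc1b891d793.log: RUN-37 mirror world rc 0 / 0 warnings / 7/7 trio) (`HOME/mc/pub-hodgecm-mc-carch-1/pkg38/HodgeCM/Model/ArchKTypeOfTwist.lean`, md5 2fc1b891d793, 122 lines);
landed by the second packager (p2) in gate run 38 as `HodgeCM/Model/ArchKTypeOfTwist.lean` (verbatim).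
-/
/-
Copyright (c) 2026. Released under Apache 2.0 license as described in the file LICENSE.
Cell pub-hodgecm, MODEL layer (construction prover mc-carch-1, gen 0), BINDER-OWNERS row 12 `C` / row 14 `hpd`: the chart twist.
`twistU21 (expP b) = expP (embTwist ∘ b)` and the branch-free transfer of (AN) `IsWeaklyPDiff` from the chart `twistU21 ∘ expP`
(where BRICK 4 ∘ #CA8/#CA9 deliver it) to E's chart `expP`.
-/
import Summits.HodgeConjecture.HodgeCM.Model.ArchKTypeOfFrameMatch_2
import Summits.HodgeConjecture.HodgeCM.Model.ThetaHolAssembly_2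

/-!
# The twist on the exponential chart, and (AN) along `expP`

* § 1 `Matrix.exp_map_starRingEnd : exp (A.map conj) = (exp A).map conj` (from Mathlib's `exp_transpose`, `exp_conjTranspose`),
  `pMat_map_starRingEnd : (X_b).map conj = X_{conj ∘ b}`, whence **`twistU21_expP : twistU21 L ι₁ (expP b) = expP (embTwist L ι₁ ∘ b)`**
  (both branches of `embTwist` at once: it is `id` or `conj`);
* § 2 `exists_twistVecCLE`: `b ↦ embTwist ∘ b` is a continuous `ℝ`-linear automorphism of `ℂ²`;
  `ArchKTypeData.isWeaklyPDiff_comp_iff`: (AN) is invariant under continuous `ℝ`-linear automorphisms of the chart's source;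
  **`ArchKTypeData.isWeaklyPDiff_twistVec_iff : B.IsWeaklyPDiff (e ∘ (embTwist ∘ ·)) ↔ B.IsWeaklyPDiff e`** for every
  archimedean `K`-type datum `B` and chart `e : ℂ² → G₁` (at the honest pin `e := expP`, `G₁ = U(2,1)`, and by `twistU21_comp_expP`
  the left side is (AN) along `twistU21 ∘ expP`).
((REP) `IsPMinusKilled` is NOT invariant: along `expP ∘ conj` it is the `𝔭⁺` relation — see STATUS (TWIST-2).)
Nothing is cited and nothing is minted: kernel lemmas.
-/

set_option autoImplicit false

noncomputable section

open NumberField NumberField.InfinitePlace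
open scoped Matrix Classical
open Literature.Geometry.ComplexHyperbolic.BallModel (U21 mat mat_injective)
open Literature.AlgebraicGeometry.ShimuraVarieties.BallForms (expP pMat mat_expP)
open Literature.NumberTheory.Automorphic

/-! ## § 1 The twist of the exponential chart -/

namespace Matrix

/-- `exp` commutes with entrywise complex conjugation. -/
theorem exp_map_starRingEnd {m : Type} [Fintype m] [DecidableEq m] (A : Matrix m m ℂ) :
    NormedSpace.exp (A.map (starRingEnd ℂ)) = (NormedSpace.exp A).map (starRingEnd ℂ) := by
  have h : ∀ B : Matrix m m ℂ, B.map (starRingEnd ℂ) = (Bᴴ)ᵀ := fun B => by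
    ext i j; rfl
  rw [h, h, Matrix.exp_transpose, Matrix.exp_conjTranspose]

end Matrix

namespace HodgeCM.Model

/-- `X_b` entrywise conjugated is `X_{conj ∘ b}`. -/
theorem pMat_map_starRingEnd (b : Fin 2 → ℂ) :
    (pMat b).map (starRingEnd ℂ) = pMat fun i => starRingEnd ℂ (b i) := by
  ext i j
  fin_cases i <;> fin_cases j <;> simp [pMat]

variable {L : CMField} {ι₁ : L →+* ℂ}

/-- **`twistU21 (expP b) = expP (embTwist ∘ b)`** (the twist is `id` or entrywise `conj`; `exp` commutes with both). -/
theorem twistU21_expP (b : Fin 2 → ℂ) :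
    twistU21 L ι₁ (expP b) = expP fun i => UnitaryGroup.embTwist (L : Type) ι₁ (b i) := by
  apply mat_injective
  show (mat (expP b)).map (UnitaryGroup.embTwist (L : Type) ι₁) = mat (expP _)
  rw [mat_expP, mat_expP]
  by_cases h : (InfinitePlace.mk ι₁).embedding = ι₁
  · have hφ : UnitaryGroup.embTwist (L : Type) ι₁ = RingHom.id ℂ := by rw [UnitaryGroup.embTwist, if_pos h]
    rw [hφ, RingHom.coe_id, Matrix.map_id]
    rfl
  · have hφ : UnitaryGroup.embTwist (L : Type) ι₁ = starRingEnd ℂ := by rw [UnitaryGroup.embTwist, if_neg h]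
    rw [hφ, ← Matrix.exp_map_starRingEnd, pMat_map_starRingEnd]

/-- as charts: `twistU21 ∘ expP = expP ∘ (embTwist ∘ ·)`. -/
theorem twistU21_comp_expP :
    (fun b => twistU21 L ι₁ (expP b)) = fun b : Fin 2 → ℂ => expP fun i => UnitaryGroup.embTwist (L : Type) ι₁ (b i) :=
  funext twistU21_expP

/-! ## § 2 (AN) along `expP` from (AN) along `twistU21 ∘ expP` -/

/-- `b ↦ embTwist ∘ b` is a continuous `ℝ`-linear automorphism of `ℂ²` (the identity or coordinatewise `conj`). -/
theorem exists_twistVecCLE :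
    ∃ c : (Fin 2 → ℂ) ≃L[ℝ] (Fin 2 → ℂ), ∀ b, c b = fun i => UnitaryGroup.embTwist (L : Type) ι₁ (b i) := by
  by_cases h : (InfinitePlace.mk ι₁).embedding = ι₁
  · exact ⟨ContinuousLinearEquiv.refl ℝ _, fun b => funext fun i => (UnitaryGroup.embTwist_apply_of_eq (L : Type) ι₁ h _).symm⟩
  · exact ⟨ContinuousLinearEquiv.piCongrRight fun _ => Complex.conjCLE,
      fun b => funext fun i => (UnitaryGroup.embTwist_apply_of_ne (L : Type) ι₁ h _).symm⟩

namespace ArchKTypeData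

open NumberField.mixedEmbedding
open scoped SchwartzMap

variable {U : Universe} {V : HermSpace3 L ι₁} {c : SeesawCtx L}
variable {X : ThetaSpaceInput U V c} {k : Fin 4} {N : ℕ} (B : ArchKTypeData X k N)

/-- (AN) is invariant under a continuous `ℝ`-linear automorphism of the chart's source. -/
theorem isWeaklyPDiff_comp_iff {P' : Type*} [NormedAddCommGroup P'] [NormedSpace ℝ P'] (e : P' → X.G₁) (c : P' ≃L[ℝ] P') :
    B.IsWeaklyPDiff (e ∘ c) ↔ B.IsWeaklyPDiff e := by
  constructor
  · intro h T ℓ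
    have h1 := h T ℓ
    have hc0 : c.symm 0 = 0 := map_zero _
    have h2 : DifferentiableAt ℝ ((fun b => T (B.ωinf ((e ∘ c) b) (B.Φarch ℓ))) ∘ c.symm) 0 :=
      (hc0.symm ▸ h1).comp 0 c.symm.differentiableAt
    refine h2.congr_of_eventuallyEq (Filter.Eventually.of_forall fun b => ?_)
    simp only [Function.comp_apply, ContinuousLinearEquiv.apply_symm_apply]
  · intro h T ℓ
    have h1 := h T ℓ
    have hc0 : c 0 = 0 := map_zero _
    exact (hc0.symm ▸ h1).comp 0 c.differentiableAt

/-- **(AN) along `e ∘ (embTwist ∘ ·)` ⟺ (AN) along `e`** for every chart `e : ℂ² → G₁` — with `e := expP` at the honest pin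
(`G₁ = U(2,1)`) and `twistU21_comp_expP` this is the row-14 transfer `IsWeaklyPDiff (twistU21 ∘ expP) ↔ IsWeaklyPDiff expP`. -/
theorem isWeaklyPDiff_twistVec_iff (e : (Fin 2 → ℂ) → X.G₁) :
    B.IsWeaklyPDiff (fun b : Fin 2 → ℂ => e fun i => UnitaryGroup.embTwist (L : Type) ι₁ (b i)) ↔ B.IsWeaklyPDiff e := by
  obtain ⟨cw, hcw⟩ := exists_twistVecCLE (L := L) (ι₁ := ι₁)
  have he : (fun b : Fin 2 → ℂ => e fun i => UnitaryGroup.embTwist (L : Type) ι₁ (b i)) = e ∘ cw := by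
    funext b
    rw [Function.comp_apply, hcw b]
  rw [he, isWeaklyPDiff_comp_iff]

end ArchKTypeData

end HodgeCM.Model
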